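import Summits.BirchSwinnertonDyer.BirchSwinnertonDyer.Theorems.GoldfeldAllTwistsTwoConverseTwinHalfTraceSevenModEightRankOne
import HarnessLib

set_option linter.dupNamespace false -- namespace `…BirchSwinnertonDyer.BirchSwinnertonDyer…` is the cell's (D-0017 nested layout)
set_option autoImplicit false

/-!
# LINE C3⁺ (PHASE 2), file P2-G: GENERIC `χ`-DESCENT — the `χ`-part of `X₀(49)` over a Galois extension `L/K` has rank
# at most one as soon as the `K/ℚ`-step holds for the partner curve `V₁ = (49a1^{(d)})^{(1)}` (A″'s (RO″) made generic in `d`)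

Cell `bsd-goldfeld`, seat `bsd-goldfeld-s1p-c3x` (gen 7); planner ORDER (ccxxix)/(ccxxxi) «LINE C3⁺», tranche 2: the common descent
skeleton of the three partner files P2c (`χ_q`, `d = −q`), P2d (`χ_p`, `d = p`), P2e (`χ_e = χ_qχ_p`, `d = −qp`).
`--supports stmt-BirchSwinnertonDyer-20044` as a HELPER. Theses-free; theorems only; FACT-FREE (no binder at all), no `sorry`.
HONEST FRAMING: descent algebra; no `L`-value; no case of K12₂″ / twin″ decided; BSD is not proved by any of this.

SETTING: `K` imaginary quadratic; `L/K` finite Galois; `d ∈ ℚ` NOT a square in `K`; `r₀ ∈ L`, `r₀² = d`. A `χ`-POINT of `X₀(49)(L)`: fixed by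
every `σ ∈ Gal(L/K)` with `σ r₀ = r₀`, negated by every `σ` with `σ r₀ = −r₀`. `V₁ := (cm7^{(d)})^{(1)}` (a `ℚ`-model of `49a1^{(d)}`, `a₁ = a₃ = 0`),
`V₁^{(d_K)} ≅ 49a1^{(d·d_K)}`.
* §1 the genus field `J = K⟮r₀⟯` (`[J : K] = 2`) and the anti-invariant DESCENT of a `χ`-point to `X₀(49)(J)` (A″'s
  `exists_descent_of_isChiPoint_negEightPrime` with `−ℓ` replaced by `d`).
* §2 the `K/ℚ`-STEP in the abstract shape `∃ G ∈ V₁(K), ∀ P ∈ V₁(K), ∃ m, 2P − m•G ∈ tors`, proved in the two configurations that occur: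
  (a) `rank V₁(ℚ) = 1` and `V₁^{(d_K)}(ℚ)` torsion (`χ_q`: `49a1^{(−q)}` / `49a1^{(2p)}`; `χ_e`: `49a1^{(−qp)}` / `49a1^{(2)}`) — `G = ι(g)`;
  (b) `V₁(ℚ)` torsion and `rank V₁^{(d_K)}(ℚ) = 1` (`χ_p`: `49a1^{(p)}` with `L(49a1^{(p)},1) ≠ 0` / `49a1^{(−2q)}`) — `G` the twist of `g`.
* §3 (RO⁗) from the step: two `χ`-points `Z₁, Z₂ ∈ X₀(49)(L)` with `Z₂` of infinite order satisfy `a•Z₁ − b•Z₂ ∈ tors`, `a ≠ 0`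
  (A″'s `exists_zsmul_sub_zsmul_isOfFinAddOrder_of_isChiPoint_negEightPrime`, its use of the prime `ℓ` replaced by the step hypothesis).
The RANK inputs (CLTZ Thm 1.4, GZK, LINE C3, seat c3's `49a1^{(2)}`) are supplied BY NAME by the partner files; nothing printed is used here.

References: [CoatesLiTianZhai2015] (2.8); [SilvermanAEC2009] X.2 Prop. 2.4, X.5 Cor. 5.4, Ex. 10.16, VIII.6.7; [Gross1984] §§4–5. -/

noncomputable section

open scoped Classical IntermediateField

open WeierstrassCurve Literature.NumberTheory.EllipticCurves
  Literature.NumberTheory.EllipticCurves.ModularForms Literature.NumberTheory.EllipticCurves.CoatesLiTianZhai2015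

namespace Summit.BirchSwinnertonDyer.BirchSwinnertonDyer.Theorems.GoldfeldGoodTwists

/-! ## §1 The genus field `K⟮r₀⟯`, `r₀² = d`, and the anti-invariant descent -/

section GenusField

variable {K : Type} [Field K] [NumberField K] {L : Type*} [Field L] [CharZero L] [Algebra K L]
  [FiniteDimensional K L] [IsGalois K L]

omit [NumberField K] [CharZero L] [FiniteDimensional K L] [IsGalois K L] in
/-- `r₀ ∉ K` (inside `K⟮r₀⟯`) when `r₀² = d`, `d` not a square in `K`. [folklore] -/
theorem gen_not_mem_range_of_not_isSquare {d : K} (hd : ¬ IsSquare d) {r₀ : L} (hr : r₀ ^ 2 = algebraMap K L d) :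
    ((⟨r₀, IntermediateField.mem_adjoin_simple_self K r₀⟩ : K⟮r₀⟯) : K⟮r₀⟯) ∉ Set.range (algebraMap K K⟮r₀⟯) := by
  rintro ⟨κ, hκ⟩
  have hκL : algebraMap K L κ = r₀ := by
    have := congrArg Subtype.val hκ
    simpa using this
  exact algebraMap_ne_sqrt_of_not_isSquare hr hd κ hκL

omit [NumberField K] [CharZero L] [FiniteDimensional K L] [IsGalois K L] in
/-- `r₀² = d` inside `K⟮r₀⟯`. [folklore] -/
theorem gen_sq_of_sq_eq {d : K} {r₀ : L} (hr : r₀ ^ 2 = algebraMap K L d) :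
    (⟨r₀, IntermediateField.mem_adjoin_simple_self K r₀⟩ : K⟮r₀⟯) ^ 2 = algebraMap K K⟮r₀⟯ d := by
  apply Subtype.ext
  push_cast
  rw [hr]
  rfl

/-- **Descent of a `χ`-point to the genus field, with anti-invariance** (generic `d`): a `χ`-point `Z ∈ X₀(49)(L)` is the image of a
point `z ∈ X₀(49)(K⟮r₀⟯)` NEGATED by the non-trivial `K`-automorphism of `K⟮r₀⟯` (`Quadratic.conj`, `r₀ ↦ −r₀`).
[cite: Gross1984, §§4–5] [cite: CoatesLiTianZhai2015, (2.8)] -/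
theorem exists_descent_of_isChiPoint {d : K} {r₀ : L}
    (hfin : Module.finrank K K⟮r₀⟯ = 2)
    (hθ : ((⟨r₀, IntermediateField.mem_adjoin_simple_self K r₀⟩ : K⟮r₀⟯) : K⟮r₀⟯) ∉ Set.range (algebraMap K K⟮r₀⟯))
    (hi : (⟨r₀, IntermediateField.mem_adjoin_simple_self K r₀⟩ : K⟮r₀⟯) ^ 2 = algebraMap K K⟮r₀⟯ d)
    (Z : (cm7.baseChange L).toAffine.Point)
    (hZfix : ∀ σ : L ≃ₐ[K] L, σ r₀ = r₀ → Affine.Point.map (σ : L →ₐ[K] L) Z = Z)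
    (hZneg : ∀ σ : L ≃ₐ[K] L, σ r₀ = -r₀ → Affine.Point.map (σ : L →ₐ[K] L) Z = -Z) :
    ∃ z : (cm7.baseChange K⟮r₀⟯).toAffine.Point,
      Affine.Point.map (algebraMap K⟮r₀⟯ L).toRatAlgHom z = Z ∧
      Affine.Point.map (W' := cm7) (Literature.NumberTheory.QuadraticFields.Quadratic.conj hfin hθ hi) z = -z := by
  obtain ⟨z, hz⟩ := exists_map_adjoin_eq_of_forall_fixing cm7 r₀ hZfix
  haveI : Normal K L := inferInstance
  obtain ⟨τ, hτ⟩ : ∃ τ : L ≃ₐ[K] L, τ = AlgEquiv.ofBijective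
      ((Literature.NumberTheory.QuadraticFields.Quadratic.conj hfin hθ hi).liftNormal L)
      (AlgHom.normal_bijective K L L _) := ⟨_, rfl⟩
  have hτcomm : ∀ x : K⟮r₀⟯, τ (algebraMap K⟮r₀⟯ L x) =
      algebraMap K⟮r₀⟯ L (Literature.NumberTheory.QuadraticFields.Quadratic.conj hfin hθ hi x) := fun x ↦ by
    rw [hτ]; exact (Literature.NumberTheory.QuadraticFields.Quadratic.conj hfin hθ hi).liftNormal_commutes L x
  have hτr : τ r₀ = -r₀ := by
    have h1 := hτcomm ⟨r₀, IntermediateField.mem_adjoin_simple_self K r₀⟩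
    rw [Literature.NumberTheory.QuadraticFields.Quadratic.conj_gen, map_neg] at h1
    simpa using h1
  refine ⟨z, hz, ?_⟩
  apply Affine.Point.map_injective (W' := cm7) (f := (algebraMap K⟮r₀⟯ L).toRatAlgHom)
  have step1 : ∀ P : (cm7.baseChange K⟮r₀⟯).toAffine.Point,
      Affine.Point.map (algebraMap K⟮r₀⟯ L).toRatAlgHom
        (Affine.Point.map (W' := cm7) (Literature.NumberTheory.QuadraticFields.Quadratic.conj hfin hθ hi) P) =
      Affine.Point.map (τ : L →ₐ[K] L) (Affine.Point.map (algebraMap K⟮r₀⟯ L).toRatAlgHom P) := by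
    intro P
    rcases P with _ | ⟨x, y, hxy⟩
    · rfl
    · simp only [Affine.Point.map_some, Affine.Point.some.injEq]
      exact ⟨by simpa using (hτcomm x).symm, by simpa using (hτcomm y).symm⟩
  rw [step1, map_neg, hz, hZneg τ hτr]

end GenusField

-- One decidability world for all point groups (ℚ, K, K⟮r₀⟯, L), exactly as in A″'s `…SevenModEightRankOne`; file-local.
attribute [local instance 2000] Classical.propDecidable

/-! ## §2 The `K/ℚ`-step for `V₁ = (cm7^{(d)})^{(1)}` in its two configurations -/

section RatStep

/-- The completed-square copy of `cm7^{(d)}` is `cm7^{(d)}` itself (`a₁ = a₃ = 0`). [cite: SilvermanAEC2009, III.1] -/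
theorem quadraticTwist_quadraticTwist_one_cm7 (d : ℚ) :
    (cm7.quadraticTwist d).quadraticTwist 1 = cm7.quadraticTwist d := by
  ext <;> simp [quadraticTwist, b₂, b₄, b₆]

/-- `V₁ = (cm7^{(d)})^{(1)}` is elliptic for `d ≠ 0`. [folklore] -/
theorem isElliptic_twist_one_cm7 {d : ℚ} (hd : d ≠ 0) : ((cm7.quadraticTwist d).quadraticTwist 1).IsElliptic := by
  rw [quadraticTwist_quadraticTwist_one_cm7]
  exact cm7.isElliptic_quadraticTwist hd

variable {K : Type} [Field K] [NumberField K]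

/-- **The `K/ℚ`-step, configuration (a): `rank V₁(ℚ) = 1`, `V₁^{(d_K)}(ℚ)` torsion.** Then `G = ι(g)` for a generator `g` of `V₁(ℚ)`
modulo torsion works: `2P = (P + σP) + (P − σP)`, the first summand `≡ m•g` along a rank-one Mordell–Weil basis, the second a twist of a
`ℚ`-point of `V₁^{(d_K)}`, torsion (A″'s `exists_two_zsmul_sub_incl_negEightPrime` with its two rank inputs made hypotheses).
[cite: SilvermanAEC2009, X.2 Prop. 2.4, Exercise 10.16 and Thm. VIII.6.7] -/
theorem exists_two_zsmul_sub_of_rank_one_of_twist_torsion (hK : IsImaginaryQuadratic K) {d : ℚ} (hd : d ≠ 0)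
    (hV : (haveI := isElliptic_twist_one_cm7 hd; ((cm7.quadraticTwist d).quadraticTwist 1).mordellWeilRank) = 1)
    (hT : ∀ R : ((cm7.quadraticTwist d).quadraticTwist (NumberField.discr K : ℚ)).toAffine.Point, IsOfFinAddOrder R) :
    ∃ G : (((cm7.quadraticTwist d).quadraticTwist 1).baseChange K).toAffine.Point,
      ∀ P : (((cm7.quadraticTwist d).quadraticTwist 1).baseChange K).toAffine.Point,
        ∃ m : ℤ, IsOfFinAddOrder ((2 : ℤ) • P - m • G) := by
  haveI := isElliptic_twist_one_cm7 hd
  obtain ⟨B, hB⟩ := exists_isMordellWeilBasis_fin_one _ hV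
  refine ⟨QuadraticDescent.incl K ((cm7.quadraticTwist d).quadraticTwist 1) (B 0), fun P => ?_⟩
  obtain ⟨δ, hδ, hδK, -⟩ := exists_sq_eq_discr_and_span hK
  have hθ : δ ∉ Set.range (algebraMap ℚ K) := by rintro ⟨a, ha⟩; exact hδK a ha
  have hσσ : ∀ z, Literature.NumberTheory.QuadraticFields.Quadratic.conj hK.1 hθ hδ
      (Literature.NumberTheory.QuadraticFields.Quadratic.conj hK.1 hθ hδ z) = z :=
    Literature.NumberTheory.QuadraticFields.Quadratic.conj_conj hK.1 hθ hδ
  obtain ⟨Q, hQ⟩ : ∃ Q : ((cm7.quadraticTwist d).quadraticTwist 1).toAffine.Point,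
      QuadraticDescent.incl K ((cm7.quadraticTwist d).quadraticTwist 1) Q =
      P + QuadraticDescent.conjMap ((cm7.quadraticTwist d).quadraticTwist 1)
        (Literature.NumberTheory.QuadraticFields.Quadratic.conj hK.1 hθ hδ) P :=
    exists_incl_eq_of_conjMap_eq ((cm7.quadraticTwist d).quadraticTwist 1) hK.1 hθ hδ (by
      rw [map_add, QuadraticDescent.conjMap_conjMap ((cm7.quadraticTwist d).quadraticTwist 1) hσσ, add_comm])
  obtain ⟨R, hR⟩ : ∃ R : ((cm7.quadraticTwist d).quadraticTwist (NumberField.discr K : ℚ)).toAffine.Point,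
      QuadraticDescent.twistMap (cm7.quadraticTwist d) hθ hδ R =
        P - QuadraticDescent.conjMap ((cm7.quadraticTwist d).quadraticTwist 1)
          (Literature.NumberTheory.QuadraticFields.Quadratic.conj hK.1 hθ hδ) P :=
    exists_twistMap_eq_of_conjMap_eq_neg (cm7.quadraticTwist d) hK.1 hθ hδ (by
      rw [map_sub, QuadraticDescent.conjMap_conjMap ((cm7.quadraticTwist d).quadraticTwist 1) hσσ, neg_sub])
  obtain ⟨m, hm⟩ := exists_sub_zsmul_isOfFinAddOrder_of_isMordellWeilBasis hB Q
  refine ⟨m, ?_⟩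
  have e2 : (P + QuadraticDescent.conjMap ((cm7.quadraticTwist d).quadraticTwist 1)
        (Literature.NumberTheory.QuadraticFields.Quadratic.conj hK.1 hθ hδ) P) +
      (P - QuadraticDescent.conjMap ((cm7.quadraticTwist d).quadraticTwist 1)
        (Literature.NumberTheory.QuadraticFields.Quadratic.conj hK.1 hθ hδ) P) = (2 : ℤ) • P := by
    abel
  have hdec : (2 : ℤ) • P - m • QuadraticDescent.incl K ((cm7.quadraticTwist d).quadraticTwist 1) (B 0) =
      QuadraticDescent.incl K ((cm7.quadraticTwist d).quadraticTwist 1) (Q - m • B 0) +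
        QuadraticDescent.twistMap (cm7.quadraticTwist d) hθ hδ R := by
    rw [← e2, ← hQ, hR, map_sub, map_zsmul]
    abel
  rw [hdec]
  exact isOfFinAddOrder_add'
    ((QuadraticDescent.incl K ((cm7.quadraticTwist d).quadraticTwist 1)).isOfFinAddOrder hm)
    ((QuadraticDescent.twistMap _ hθ hδ).isOfFinAddOrder (hT R))

/-- **The `K/ℚ`-step, configuration (b): `V₁(ℚ)` torsion, `rank V₁^{(d_K)}(ℚ) = 1.** Then `G` = the twist of a generator `g` of
`V₁^{(d_K)}(ℚ)` modulo torsion works: in `2P = (P + σP) + (P − σP)` the FIRST summand is torsion and the second is the twist of a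
`ℚ`-point `≡ m•g`. [cite: SilvermanAEC2009, X.2 Prop. 2.4, Exercise 10.16 and Thm. VIII.6.7] -/
theorem exists_two_zsmul_sub_of_torsion_of_twist_rank_one (hK : IsImaginaryQuadratic K) {d : ℚ} (hd : d ≠ 0)
    (hV0 : ∀ Q : ((cm7.quadraticTwist d).quadraticTwist 1).toAffine.Point, IsOfFinAddOrder Q)
    (hT1 : (haveI := cm7.isElliptic_quadraticTwist hd;
      haveI := (cm7.quadraticTwist d).isElliptic_quadraticTwist
        (show (NumberField.discr K : ℚ) ≠ 0 by exact_mod_cast NumberField.discr_ne_zero K);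
      ((cm7.quadraticTwist d).quadraticTwist (NumberField.discr K : ℚ)).mordellWeilRank) = 1) :
    ∃ G : (((cm7.quadraticTwist d).quadraticTwist 1).baseChange K).toAffine.Point,
      ∀ P : (((cm7.quadraticTwist d).quadraticTwist 1).baseChange K).toAffine.Point,
        ∃ m : ℤ, IsOfFinAddOrder ((2 : ℤ) • P - m • G) := by
  haveI := isElliptic_twist_one_cm7 hd
  haveI := cm7.isElliptic_quadraticTwist hd
  haveI := (cm7.quadraticTwist d).isElliptic_quadraticTwist
    (show (NumberField.discr K : ℚ) ≠ 0 by exact_mod_cast NumberField.discr_ne_zero K)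
  obtain ⟨B, hB⟩ := exists_isMordellWeilBasis_fin_one _ hT1
  obtain ⟨δ, hδ, hδK, -⟩ := exists_sq_eq_discr_and_span hK
  have hθ : δ ∉ Set.range (algebraMap ℚ K) := by rintro ⟨a, ha⟩; exact hδK a ha
  have hσσ : ∀ z, Literature.NumberTheory.QuadraticFields.Quadratic.conj hK.1 hθ hδ
      (Literature.NumberTheory.QuadraticFields.Quadratic.conj hK.1 hθ hδ z) = z :=
    Literature.NumberTheory.QuadraticFields.Quadratic.conj_conj hK.1 hθ hδ
  refine ⟨QuadraticDescent.twistMap (cm7.quadraticTwist d) hθ hδ (B 0), fun P => ?_⟩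
  obtain ⟨Q, hQ⟩ : ∃ Q : ((cm7.quadraticTwist d).quadraticTwist 1).toAffine.Point,
      QuadraticDescent.incl K ((cm7.quadraticTwist d).quadraticTwist 1) Q =
      P + QuadraticDescent.conjMap ((cm7.quadraticTwist d).quadraticTwist 1)
        (Literature.NumberTheory.QuadraticFields.Quadratic.conj hK.1 hθ hδ) P :=
    exists_incl_eq_of_conjMap_eq ((cm7.quadraticTwist d).quadraticTwist 1) hK.1 hθ hδ (by
      rw [map_add, QuadraticDescent.conjMap_conjMap ((cm7.quadraticTwist d).quadraticTwist 1) hσσ, add_comm])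
  obtain ⟨R, hR⟩ : ∃ R : ((cm7.quadraticTwist d).quadraticTwist (NumberField.discr K : ℚ)).toAffine.Point,
      QuadraticDescent.twistMap (cm7.quadraticTwist d) hθ hδ R =
        P - QuadraticDescent.conjMap ((cm7.quadraticTwist d).quadraticTwist 1)
          (Literature.NumberTheory.QuadraticFields.Quadratic.conj hK.1 hθ hδ) P :=
    exists_twistMap_eq_of_conjMap_eq_neg (cm7.quadraticTwist d) hK.1 hθ hδ (by
      rw [map_sub, QuadraticDescent.conjMap_conjMap ((cm7.quadraticTwist d).quadraticTwist 1) hσσ, neg_sub])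
  obtain ⟨m, hm⟩ := exists_sub_zsmul_isOfFinAddOrder_of_isMordellWeilBasis hB R
  refine ⟨m, ?_⟩
  have e2 : (P + QuadraticDescent.conjMap ((cm7.quadraticTwist d).quadraticTwist 1)
        (Literature.NumberTheory.QuadraticFields.Quadratic.conj hK.1 hθ hδ) P) +
      (P - QuadraticDescent.conjMap ((cm7.quadraticTwist d).quadraticTwist 1)
        (Literature.NumberTheory.QuadraticFields.Quadratic.conj hK.1 hθ hδ) P) = (2 : ℤ) • P := by
    abel
  have hdec : (2 : ℤ) • P - m • QuadraticDescent.twistMap (cm7.quadraticTwist d) hθ hδ (B 0) =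
      QuadraticDescent.incl K ((cm7.quadraticTwist d).quadraticTwist 1) Q +
        QuadraticDescent.twistMap (cm7.quadraticTwist d) hθ hδ (R - m • B 0) := by
    rw [← e2, ← hQ, map_sub, map_zsmul, hR]
    abel
  rw [hdec]
  exact isOfFinAddOrder_add'
    ((QuadraticDescent.incl K ((cm7.quadraticTwist d).quadraticTwist 1)).isOfFinAddOrder (hV0 Q))
    ((QuadraticDescent.twistMap _ hθ hδ).isOfFinAddOrder hm)

end RatStep

/-! ## §3 (RO⁗) — the `χ`-part has rank at most one, from the `K/ℚ`-step -/

section ChiPartRankOne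

variable {K : Type} [Field K] [NumberField K] {L : Type*} [Field L] [CharZero L] [Algebra K L]
  [FiniteDimensional K L] [IsGalois K L]

/-- `(cm7 ⊗ K)^{(d)} = ((cm7^{(d)})^{(1)}) ⊗ K` for `d ∈ ℚ` — the partner curve read over `K`. [cite: SilvermanAEC2009, X.2 Prop. 2.4] -/
theorem cm7_baseChange_quadraticTwist_ratCast (K : Type) [Field K] [NumberField K] (d : ℚ) :
    (cm7.baseChange K).quadraticTwist (algebraMap ℚ K d) = ((cm7.quadraticTwist d).quadraticTwist 1).baseChange K := by
  rw [quadraticTwist_quadraticTwist_one_cm7, baseChange, baseChange, map_quadraticTwist]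

/-- If `2 • u` has finite order then so has `u` (local helper). [folklore] -/
private theorem tors_of_two_zsmul'' {A : Type*} [AddCommGroup A] {u : A} (h : IsOfFinAddOrder ((2 : ℤ) • u)) :
    IsOfFinAddOrder u := by
  obtain ⟨n, hn, hnu⟩ := (isOfFinAddOrder_iff_zsmul_eq_zero).mp h
  exact (isOfFinAddOrder_iff_zsmul_eq_zero).mpr ⟨n * 2, mul_ne_zero hn two_ne_zero, by rw [mul_smul, hnu]⟩

/-- **(RO⁗) — THE `χ`-PART OF `X₀(49)(L)` HAS RANK AT MOST ONE, from the `K/ℚ`-step.** `K` a number field, `L/K` finite Galois,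
`d ∈ ℚ` not a square in `K`, `r₀ ∈ L` with `r₀² = d`; granted the step `∃ G, ∀ P ∈ V₁(K), ∃ m, 2P − m•G ∈ tors` for `V₁ = (cm7^{(d)})^{(1)}`
(§2), two `χ`-points `Z₁, Z₂ ∈ X₀(49)(L)` with `Z₂` of infinite order have `a•Z₁ − b•Z₂ ∈ tors` for some `a ≠ 0`, `b`.
[cite: CoatesLiTianZhai2015, (2.8)] [cite: SilvermanAEC2009, X.2 Prop. 2.4, Exercise 10.16] [cite: Gross1984, §§4–5] -/
theorem exists_zsmul_sub_zsmul_isOfFinAddOrder_of_isChiPoint_of_step {d : ℚ}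
    (hd : ¬ IsSquare (algebraMap ℚ K d)) {r₀ : L} (hr : r₀ ^ 2 = algebraMap K L (algebraMap ℚ K d))
    (hstep : ∃ G : (((cm7.quadraticTwist d).quadraticTwist 1).baseChange K).toAffine.Point,
      ∀ P : (((cm7.quadraticTwist d).quadraticTwist 1).baseChange K).toAffine.Point,
        ∃ m : ℤ, IsOfFinAddOrder ((2 : ℤ) • P - m • G))
    (Z₁ Z₂ : (cm7.baseChange L).toAffine.Point)
    (h₁fix : ∀ σ : L ≃ₐ[K] L, σ r₀ = r₀ → Affine.Point.map (σ : L →ₐ[K] L) Z₁ = Z₁)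
    (h₁neg : ∀ σ : L ≃ₐ[K] L, σ r₀ = -r₀ → Affine.Point.map (σ : L →ₐ[K] L) Z₁ = -Z₁)
    (h₂fix : ∀ σ : L ≃ₐ[K] L, σ r₀ = r₀ → Affine.Point.map (σ : L →ₐ[K] L) Z₂ = Z₂)
    (h₂neg : ∀ σ : L ≃ₐ[K] L, σ r₀ = -r₀ → Affine.Point.map (σ : L →ₐ[K] L) Z₂ = -Z₂)
    (hZ₂ : ¬ IsOfFinAddOrder Z₂) :
    ∃ a b : ℤ, a ≠ 0 ∧ IsOfFinAddOrder (a • Z₁ - b • Z₂) := by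
  have hfin : Module.finrank K K⟮r₀⟯ = 2 := finrank_adjoin_sqrt_eq_two (L := L) hr hd
  have hθ := gen_not_mem_range_of_not_isSquare hd hr
  have hi := gen_sq_of_sq_eq (K := K) hr
  obtain ⟨z₁, hz₁, hanti₁⟩ := exists_descent_of_isChiPoint hfin hθ hi Z₁ h₁fix h₁neg
  obtain ⟨z₂, hz₂, hanti₂⟩ := exists_descent_of_isChiPoint hfin hθ hi Z₂ h₂fix h₂neg
  -- re-read the default-world statements in this file's instance world
  have hz₁' : Affine.Point.map (W' := cm7) (algebraMap K⟮r₀⟯ L).toRatAlgHom z₁ = Z₁ := by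
    rw [← hz₁]; rcases z₁ with _ | ⟨x, y, hxy⟩ <;> rfl
  have hz₂' : Affine.Point.map (W' := cm7) (algebraMap K⟮r₀⟯ L).toRatAlgHom z₂ = Z₂ := by
    rw [← hz₂]; rcases z₂ with _ | ⟨x, y, hxy⟩ <;> rfl
  have hanti₁' : Affine.Point.map (W' := cm7)
      (Literature.NumberTheory.QuadraticFields.Quadratic.conj hfin hθ hi) z₁ = -z₁ := by
    rcases z₁ with _ | ⟨x, y, hxy⟩ <;> [rfl; exact hanti₁]
  have hanti₂' : Affine.Point.map (W' := cm7)
      (Literature.NumberTheory.QuadraticFields.Quadratic.conj hfin hθ hi) z₂ = -z₂ := by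
    rcases z₂ with _ | ⟨x, y, hxy⟩ <;> [rfl; exact hanti₂]
  -- the completing-square transport `e : X₀(49)(K⟮r₀⟯) ≃ (cm7 ⊗ K)^{(1)}(K⟮r₀⟯)`, natural in `Gal(K⟮r₀⟯/K)` (A″ verbatim)
  have hbb : (cm7.baseChange K).baseChange K⟮r₀⟯ = cm7.baseChange K⟮r₀⟯ :=
    cm7.map_baseChange (IsScalarTower.toAlgHom ℚ K K⟮r₀⟯)
  have hC := completeSquare_smul_cm7_baseChange K
  let e₀ : (cm7.baseChange K⟮r₀⟯).toAffine.Point ≃+ ((cm7.baseChange K).baseChange K⟮r₀⟯).toAffine.Point :=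
    Affine.Point.congrEquiv hbb.symm
  let e₁ := VariableChange.pointEquivBaseChange (cm7.baseChange K)
    (((⟨1, 0, -(1 / 2 : ℚ), 0⟩ : VariableChange ℚ).map (algebraMap ℚ K))) K⟮r₀⟯
  let e₂ := Affine.Point.congrEquiv (congrArg (fun X : WeierstrassCurve K => X.baseChange K⟮r₀⟯) hC)
  let e := e₀.trans (e₁.trans e₂)
  have hσ : ∀ P : (cm7.baseChange K⟮r₀⟯).toAffine.Point,
      Affine.Point.map (W' := (cm7.baseChange K).quadraticTwist 1)
          (Literature.NumberTheory.QuadraticFields.Quadratic.conj hfin hθ hi) (e P) =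
        e (Affine.Point.map (W' := cm7) (Literature.NumberTheory.QuadraticFields.Quadratic.conj hfin hθ hi) P) := by
    intro P
    have h0 : ∀ Q : (cm7.baseChange K⟮r₀⟯).toAffine.Point,
        Affine.Point.map (W' := cm7.baseChange K)
            (Literature.NumberTheory.QuadraticFields.Quadratic.conj hfin hθ hi) (e₀ Q) =
          e₀ (Affine.Point.map (W' := cm7) (Literature.NumberTheory.QuadraticFields.Quadratic.conj hfin hθ hi) Q) := by
      intro Q
      rcases Q with _ | ⟨x, y, hxy⟩
      · simp [e₀, Affine.Point.congrEquiv_zero, ← Affine.Point.zero_def]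
      · simp only [e₀, Affine.Point.congrEquiv_some, Affine.Point.map_some]
    show Affine.Point.map _ (e₂ (e₁ (e₀ P))) = e₂ (e₁ (e₀ (Affine.Point.map _ P)))
    rw [← h0, ← VariableChange.pointEquivBaseChange_map]
    exact map_congrEquiv_baseChange hC _ _
  have hanti : ∀ z : (cm7.baseChange K⟮r₀⟯).toAffine.Point,
      Affine.Point.map (W' := cm7) (Literature.NumberTheory.QuadraticFields.Quadratic.conj hfin hθ hi) z = -z →
      QuadraticDescent.conjMap ((cm7.baseChange K).quadraticTwist 1)
        (Literature.NumberTheory.QuadraticFields.Quadratic.conj hfin hθ hi) (e z) = -(e z) := by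
    intro z hz
    have h1 := hσ z
    rw [hz, map_neg] at h1
    exact h1
  -- both points are twists of `K`-points of the partner `(cm7 ⊗ K)^{(d)}`
  obtain ⟨R₁, hR₁⟩ := exists_twistMap_eq_of_conjMap_eq_neg (cm7.baseChange K) hfin hθ hi (hanti z₁ hanti₁')
  obtain ⟨R₂, hR₂⟩ := exists_twistMap_eq_of_conjMap_eq_neg (cm7.baseChange K) hfin hθ hi (hanti z₂ hanti₂')
  let κ : ((cm7.baseChange K).quadraticTwist (algebraMap ℚ K d)).toAffine.Point ≃+
      ((((cm7.quadraticTwist d).quadraticTwist 1)).baseChange K).toAffine.Point :=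
    Affine.Point.congrEquiv (cm7_baseChange_quadraticTwist_ratCast K d)
  -- the `K/ℚ` step (§2, a hypothesis here)
  obtain ⟨G, hg⟩ := hstep
  obtain ⟨m₁, hm₁⟩ := hg (κ R₁)
  obtain ⟨m₂, hm₂⟩ := hg (κ R₂)
  -- `m₂ ≠ 0` since `Z₂` has infinite order
  have hm₂0 : m₂ ≠ 0 := by
    rintro rfl
    apply hZ₂
    rw [zero_smul, sub_zero] at hm₂
    have hR₂t : IsOfFinAddOrder R₂ := by
      have h := κ.symm.toAddMonoidHom.isOfFinAddOrder hm₂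
      rw [map_zsmul, AddEquiv.coe_toAddMonoidHom, AddEquiv.symm_apply_apply] at h
      exact tors_of_two_zsmul'' h
    have hz₂t : IsOfFinAddOrder z₂ := by
      have h := (QuadraticDescent.twistMap (cm7.baseChange K) hθ hi).isOfFinAddOrder hR₂t
      rw [hR₂] at h
      simpa using e.symm.toAddMonoidHom.isOfFinAddOrder h
    rw [← hz₂']
    exact (Affine.Point.map (W' := cm7) (algebraMap K⟮r₀⟯ L).toRatAlgHom).isOfFinAddOrder hz₂t
  -- the relation `m₂•(2κR₁) − m₁•(2κR₂) ∈ tors`, pushed back to `L`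
  refine ⟨2 * m₂, 2 * m₁, mul_ne_zero two_ne_zero hm₂0, ?_⟩
  have hrel : IsOfFinAddOrder (m₂ • ((2 : ℤ) • κ R₁) - m₁ • ((2 : ℤ) • κ R₂)) := by
    have eq : m₂ • ((2 : ℤ) • κ R₁) - m₁ • ((2 : ℤ) • κ R₂) =
        m₂ • ((2 : ℤ) • κ R₁ - m₁ • G) - m₁ • ((2 : ℤ) • κ R₂ - m₂ • G) := by
      rw [smul_sub, smul_sub, smul_smul m₂ m₁, smul_smul m₁ m₂, mul_comm m₁ m₂]
      abel
    rw [eq]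
    have ha := isOfFinAddOrder_zsmul m₂ hm₁
    have hb := isOfFinAddOrder_zsmul m₁ hm₂
    rw [← AddCommGroup.mem_torsion] at ha hb ⊢
    exact sub_mem ha hb
  have h1 : IsOfFinAddOrder (m₂ • ((2 : ℤ) • R₁) - m₁ • ((2 : ℤ) • R₂)) := by
    have h := κ.symm.toAddMonoidHom.isOfFinAddOrder hrel
    simpa using h
  have h2 : IsOfFinAddOrder (m₂ • ((2 : ℤ) • e z₁) - m₁ • ((2 : ℤ) • e z₂)) := by
    have h := (QuadraticDescent.twistMap (cm7.baseChange K) hθ hi).isOfFinAddOrder h1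
    rw [map_sub, map_zsmul, map_zsmul, map_zsmul, map_zsmul, hR₁, hR₂] at h
    exact h
  have h3' : IsOfFinAddOrder (m₂ • ((2 : ℤ) • z₁) - m₁ • ((2 : ℤ) • z₂)) := by
    have h := e.symm.toAddMonoidHom.isOfFinAddOrder h2
    simpa using h
  have h4 := (Affine.Point.map (W' := cm7) (algebraMap K⟮r₀⟯ L).toRatAlgHom).isOfFinAddOrder h3'
  rw [map_sub, map_zsmul, map_zsmul, map_zsmul, map_zsmul, hz₁', hz₂'] at h4
  rw [mul_comm (2 : ℤ) m₂, mul_comm (2 : ℤ) m₁, ← smul_smul, ← smul_smul]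
  exact h4

end ChiPartRankOne

end Summit.BirchSwinnertonDyer.BirchSwinnertonDyer.Theorems.GoldfeldGoodTwists

end
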